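import Summits.NavierStokesRegularity.FunctionalMining.TopEigGapCoerciveSimpleAux
import Summits.NavierStokesRegularity.FunctionalMining.TopEigBoxLaplacianFlux
import Summits.NavierStokesRegularity.FunctionalMining.TopEigCutoffRamp
import HarnessLib

/-!
# FunctionalMining — L-λ(η), step (iv)(a): the cut-off fields `G_δ(λ₁)`, `G_δ(λ₁)·P₁`,
# `G_δ(λ₁)·∂ₖλ₁` are GLOBALLY smooth on fields whose top strain eigenvalue is simple wherever `λ₁ ≥ δ`

Search for candidate a priori estimates; no regularity claim. Cell `pub-nsfunc`, prove seat
(gen 26). Toward the dictionary's node `TopEigGapCoerciveTwo η` (Proposition L-λ(η) at `q = 2`,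
`TopEigHeatCoerciveGap.lean`): on the top-gap class `λ₂ ≤ (1 − η)λ₁` the top eigenvalue is simple
exactly where the strain does not vanish, so `λ₁`, the projector `P₁ = topProj v` and `∂ₖλ₁` are smooth
only on the open set `{S ≠ 0}`. Composing with the smooth ramp `G_δ = cutRamp δ` of
`TopEigCutoffRamp` (identically `0` on `(−∞, δ]`) removes the singular set: the products are locally a
smooth function near every point with `λ₁ ≥ δ` (chart lemmas of `TopEigDensityLocal`,
`TopEigBoxLaplacianFlux`) and identically `0` near every point with `λ₁ < δ`.

CONTENT (namespace `Summit.NavierStokesRegularity.FunctionalMining.TopEig`; `v` smooth on `T³`):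
* local smoothness at a simple point `x` (`λ₂(x) < λ₁(x)`): the tree's
  `contDiffAt_liftAt_torusStrainTopEig_of_midEig_lt` (`TopEigSimpleGap`) for `λ₁`, and here
  `contDiffAt_liftAt_topProj_of_simple`, `contDiffAt_liftAt_partialDeriv_topEig_of_simple`;
* `hasDerivAt_coordLine_of_contDiffAt` — derivative along a coordinate line from chart smoothness;
  `partialDeriv_eq_zero_of_eventuallyEq` — a torus function vanishing near `x` has `∂ₖ f(x) = 0`;
* **`isSmooth_cutRamp_topEig_mul`** — if `λ₂ < λ₁` at every point with `δ ≤ λ₁` (`δ > 0`) and `h` is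
  chart-smooth at every simple point, then `y ↦ G_δ(λ₁(y)) · h(y)` is `Torus.IsSmooth`; instances
  `isSmooth_cutRamp_topEig`, `isSmooth_cutRamp_topEig_mul_topProj`,
  `isSmooth_cutRamp_topEig_mul_partialDeriv_topEig`;
* `simple_of_le_topEig_of_gap` — on the top-gap class (`0 < η`), `δ ≤ λ₁(x)` with `δ > 0` forces
  `λ₂(x) < λ₁(x)`.

[ours; folklore calculus — Kato II-§5 for the chart smoothness]
-/

noncomputable section

open Filter Topology Matrix Finset MeasureTheory
open scoped ContDiff

namespace Summit.NavierStokesRegularity.FunctionalMining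

open Literature.Analysis Literature.Analysis.FunctionSpaces Literature.Analysis.FunctionSpaces.Torus
  SharpClass.DirectorForm Literature.Analysis.Matrix

namespace TopEig

variable {v : UnitAddTorus (Fin 3) → EuclideanSpace ℝ (Fin 3)}

/-! ## 1. Chart smoothness at a simple point -/

/-- At a simple point the chart of every entry of the top projector `topProj v` is `C^∞` at `0`.
[ours; folklore — Kato II-§5] -/
theorem contDiffAt_liftAt_topProj_of_simple (hv : Torus.IsSmooth v) {x : UnitAddTorus (Fin 3)}
    (hx : torusStrainMidEig v x < torusStrainTopEig v x) (i j : Fin 3) :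
    ContDiffAt ℝ ∞ (liftAt (fun z => topProj v z i j) x) 0 := by
  obtain ⟨e, he1, hSe, hg, hgap⟩ := exists_gapForm_of_midEig_lt_topEig hx
  obtain ⟨P, hPs, -, hPev⟩ := exists_smooth_topProjector_chart_of_gapForm hv he1 hSe hg hgap
  have hEq : (fun w' => P w' i j) =ᶠ[𝓝 0] liftAt (fun z => topProj v z i j) x := by
    filter_upwards [hPev] with w' hw'
    have hmem := topVec_mem_topEigSet v (x + proj w')
    rw [flat_torusStrainMatrix] at hmem
    have h := hw' _ hmem
    show P w' i j = topProj v (x + proj w') i j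
    rw [topProj, h]
  exact (hPs i j).congr_of_eventuallyEq hEq.symm

/-- At a simple point the chart of `∂ₖλ₁` is `C^∞` at `0`. [ours; folklore] -/
theorem contDiffAt_liftAt_partialDeriv_topEig_of_simple (hv : Torus.IsSmooth v)
    {x : UnitAddTorus (Fin 3)} (hx : torusStrainMidEig v x < torusStrainTopEig v x) (k : Fin 3) :
    ContDiffAt ℝ ∞ (liftAt (Torus.partialDeriv k (torusStrainTopEig v)) x) 0 :=
  (contDiffAt_liftAt_partialDeriv (contDiffAt_liftAt_torusStrainTopEig_of_midEig_lt hv hx) k).1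

/-! ## 2. Two calculus facts on the torus -/

/-- **Derivative along a coordinate line from chart smoothness**: if the chart `liftAt f x` is `C^∞`
at `0`, then `t ↦ f(x + t eₖ)` has derivative `∂ₖ f(x)` at `0`. [folklore] -/
theorem hasDerivAt_coordLine_of_contDiffAt {d : Type*} [Fintype d] [DecidableEq d]
    {f : UnitAddTorus d → ℝ} {x : UnitAddTorus d} (hf : ContDiffAt ℝ ∞ (liftAt f x) 0) (k : d) :
    HasDerivAt (fun t : ℝ => f (x + proj (t • EuclideanSpace.single k (1 : ℝ))))
      (Torus.partialDeriv k f x) 0 := by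
  have hfun : (fun t : ℝ => f (x + proj (t • EuclideanSpace.single k (1 : ℝ)))) =
      liftAt f x ∘ fun t : ℝ => t • EuclideanSpace.single k (1 : ℝ) := by
    funext t; rfl
  have hd : DifferentiableAt ℝ
      (fun t : ℝ => f (x + proj (t • EuclideanSpace.single k (1 : ℝ)))) 0 := by
    rw [hfun]
    refine DifferentiableAt.comp (0 : ℝ) ?_ (differentiableAt_id.smul_const _)
    rw [zero_smul]
    exact hf.differentiableAt (by simp)
  exact hd.hasDerivAt

/-- A torus function that vanishes on a neighbourhood of `x` has `∂ₖ f(x) = 0`. [folklore] -/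
theorem partialDeriv_eq_zero_of_eventuallyEq {F : Type*} [NormedAddCommGroup F] [NormedSpace ℝ F]
    {d : Type*} [Fintype d] [DecidableEq d] {f : UnitAddTorus d → F} {x : UnitAddTorus d}
    (h : f =ᶠ[𝓝 x] fun _ => 0) (k : d) : Torus.partialDeriv k f x = 0 := by
  have hc : Continuous fun t : ℝ => x + proj (t • EuclideanSpace.single k (1 : ℝ)) :=
    continuous_const.add (continuous_proj.comp (continuous_id.smul continuous_const))
  have hev : (fun t : ℝ => f (x + proj (t • EuclideanSpace.single k (1 : ℝ)))) =ᶠ[𝓝 0]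
      fun _ => (0 : F) := by
    have ht : Tendsto (fun t : ℝ => x + proj (t • EuclideanSpace.single k (1 : ℝ))) (𝓝 0) (𝓝 x) := by
      have hca := hc.continuousAt (x := (0 : ℝ))
      rwa [ContinuousAt, coordLine_zero] at hca
    exact ht.eventually h
  show deriv (fun t : ℝ => f (x + proj (t • EuclideanSpace.single k (1 : ℝ)))) 0 = 0
  rw [hev.deriv_eq, deriv_const]

/-! ## 3. Gluing: `G_δ(λ₁) · h` is globally smooth -/

/-- **GLUING LEMMA.** Let `v` be smooth on `T³`, `δ > 0`, and suppose `λ₂(x) < λ₁(x)` at every point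
with `δ ≤ λ₁(x)`. If `h : T³ → ℝ` is chart-smooth at every simple point, then
`y ↦ G_δ(λ₁(y)) · h(y)` is smooth on the torus: near a point with `λ₁ ≥ δ` it is a product of smooth
charts, near a point with `λ₁ < δ` it vanishes identically (`G_δ = 0` on `(−∞, δ]`, `λ₁` continuous).
[ours; folklore] -/
theorem isSmooth_cutRamp_topEig_mul (hv : Torus.IsSmooth v) {δ : ℝ} (hδ : 0 < δ)
    (hsimple : ∀ x : UnitAddTorus (Fin 3), δ ≤ torusStrainTopEig v x →
      torusStrainMidEig v x < torusStrainTopEig v x)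
    {h : UnitAddTorus (Fin 3) → ℝ}
    (hh : ∀ x : UnitAddTorus (Fin 3), torusStrainMidEig v x < torusStrainTopEig v x →
      ContDiffAt ℝ ∞ (liftAt h x) 0) :
    Torus.IsSmooth (fun y => cutRamp δ (torusStrainTopEig v y) * h y) := by
  unfold Torus.IsSmooth
  rw [← liftAt_zero_left]
  refine contDiff_iff_contDiffAt.2 fun w => ?_
  by_cases hlt : torusStrainTopEig v ((0 : UnitAddTorus (Fin 3)) + proj w) < δ
  · -- locally zero
    have hcont : Continuous fun w' : EuclideanSpace ℝ (Fin 3) =>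
        torusStrainTopEig v ((0 : UnitAddTorus (Fin 3)) + proj w') :=
      (continuous_torusStrainTopEig hv).comp (continuous_const.add continuous_proj)
    have hev : ∀ᶠ w' in 𝓝 w, torusStrainTopEig v ((0 : UnitAddTorus (Fin 3)) + proj w') < δ :=
      hcont.continuousAt.eventually_lt continuousAt_const hlt
    have hEq : liftAt (fun y => cutRamp δ (torusStrainTopEig v y) * h y) 0 =ᶠ[𝓝 w]
        fun _ => (0 : ℝ) := by
      filter_upwards [hev] with w' hw'
      rw [liftAt_apply, cutRamp_of_le hδ hw'.le, zero_mul]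
    exact contDiffAt_const.congr_of_eventuallyEq hEq
  · have hx := hsimple _ (not_lt.1 hlt)
    have h1 : ContDiffAt ℝ ∞ (liftAt (torusStrainTopEig v) 0) w :=
      contDiffAt_liftAt_of_shift (contDiffAt_liftAt_torusStrainTopEig_of_midEig_lt hv hx)
    have h2 : ContDiffAt ℝ ∞ (liftAt h 0) w := contDiffAt_liftAt_of_shift (hh _ hx)
    exact ((contDiff_cutRamp δ).contDiffAt.comp w h1).mul h2

/-- `y ↦ G_δ(λ₁(y))` is smooth (under the hypothesis of the gluing lemma). [ours] -/
theorem isSmooth_cutRamp_topEig (hv : Torus.IsSmooth v) {δ : ℝ} (hδ : 0 < δ)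
    (hsimple : ∀ x : UnitAddTorus (Fin 3), δ ≤ torusStrainTopEig v x →
      torusStrainMidEig v x < torusStrainTopEig v x) :
    Torus.IsSmooth (fun y => cutRamp δ (torusStrainTopEig v y)) := by
  have h := isSmooth_cutRamp_topEig_mul hv hδ hsimple (h := fun _ => (1 : ℝ))
    (fun x _ => contDiffAt_const)
  simp only [mul_one] at h
  exact h

/-- `y ↦ G_δ(λ₁(y)) · (topProj v y)ᵢⱼ` is smooth (under the hypothesis of the gluing lemma). [ours] -/
theorem isSmooth_cutRamp_topEig_mul_topProj (hv : Torus.IsSmooth v) {δ : ℝ} (hδ : 0 < δ)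
    (hsimple : ∀ x : UnitAddTorus (Fin 3), δ ≤ torusStrainTopEig v x →
      torusStrainMidEig v x < torusStrainTopEig v x) (i j : Fin 3) :
    Torus.IsSmooth (fun y => cutRamp δ (torusStrainTopEig v y) * topProj v y i j) :=
  isSmooth_cutRamp_topEig_mul hv hδ hsimple fun _ hx => contDiffAt_liftAt_topProj_of_simple hv hx i j

/-- `y ↦ G_δ(λ₁(y)) · ∂ₖλ₁(y)` is smooth (under the hypothesis of the gluing lemma). [ours] -/
theorem isSmooth_cutRamp_topEig_mul_partialDeriv_topEig (hv : Torus.IsSmooth v) {δ : ℝ} (hδ : 0 < δ)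
    (hsimple : ∀ x : UnitAddTorus (Fin 3), δ ≤ torusStrainTopEig v x →
      torusStrainMidEig v x < torusStrainTopEig v x) (k : Fin 3) :
    Torus.IsSmooth (fun y => cutRamp δ (torusStrainTopEig v y) *
      Torus.partialDeriv k (torusStrainTopEig v) y) :=
  isSmooth_cutRamp_topEig_mul hv hδ hsimple fun _ hx =>
    contDiffAt_liftAt_partialDeriv_topEig_of_simple hv hx k

/-! ## 4. The top-gap class: simple wherever `λ₁ > 0` -/

/-- On the top-gap class `λ₂ ≤ (1 − η)λ₁` with `η > 0`, every point with `λ₁(x) > 0` is simple.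
[ours, bookkeeping] -/
theorem simple_of_topEig_pos_of_gap {η : ℝ} (hη0 : 0 < η) {x : UnitAddTorus (Fin 3)}
    (hgapx : torusStrainMidEig v x ≤ (1 - η) * torusStrainTopEig v x)
    (hpos : 0 < torusStrainTopEig v x) : torusStrainMidEig v x < torusStrainTopEig v x := by
  have : (1 - η) * torusStrainTopEig v x < torusStrainTopEig v x := by nlinarith
  exact lt_of_le_of_lt hgapx this

/-- On the top-gap class with `η > 0` and `δ > 0`: `δ ≤ λ₁(x)` forces `λ₂(x) < λ₁(x)` — the hypothesis
of the gluing lemma. [ours, bookkeeping] -/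
theorem simple_of_le_topEig_of_gap {η δ : ℝ} (hη0 : 0 < η) (hδ : 0 < δ)
    (hgap : ∀ x : UnitAddTorus (Fin 3), torusStrainMidEig v x ≤ (1 - η) * torusStrainTopEig v x)
    (x : UnitAddTorus (Fin 3)) (hx : δ ≤ torusStrainTopEig v x) :
    torusStrainMidEig v x < torusStrainTopEig v x :=
  simple_of_topEig_pos_of_gap hη0 (hgap x) (lt_of_lt_of_le hδ hx)

/-- Where `λ₁(x) < δ`, the cut-off product `G_δ(λ₁) · h` vanishes on a neighbourhood of `x`.
[ours, bookkeeping] -/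
theorem cutRamp_topEig_mul_eventuallyEq_zero (hv : Torus.IsSmooth v) {δ : ℝ} (hδ : 0 < δ)
    (h : UnitAddTorus (Fin 3) → ℝ) {x : UnitAddTorus (Fin 3)} (hx : torusStrainTopEig v x < δ) :
    (fun y => cutRamp δ (torusStrainTopEig v y) * h y) =ᶠ[𝓝 x] fun _ => 0 := by
  have hev : ∀ᶠ y in 𝓝 x, torusStrainTopEig v y < δ :=
    (continuous_torusStrainTopEig hv).continuousAt.eventually_lt continuousAt_const hx
  filter_upwards [hev] with y hy
  rw [cutRamp_of_le hδ hy.le, zero_mul]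

/-- Where `λ₁(x) < δ`: `∂ₖ (G_δ(λ₁) · h)(x) = 0`. [ours, bookkeeping] -/
theorem partialDeriv_cutRamp_topEig_mul_eq_zero (hv : Torus.IsSmooth v) {δ : ℝ} (hδ : 0 < δ)
    (h : UnitAddTorus (Fin 3) → ℝ) {x : UnitAddTorus (Fin 3)} (hx : torusStrainTopEig v x < δ)
    (k : Fin 3) :
    Torus.partialDeriv k (fun y => cutRamp δ (torusStrainTopEig v y) * h y) x = 0 :=
  partialDeriv_eq_zero_of_eventuallyEq (cutRamp_topEig_mul_eventuallyEq_zero hv hδ h hx) k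

end TopEig

end Summit.NavierStokesRegularity.FunctionalMining

end
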